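import Literature.MathematicalPhysics.QuantumFieldTheory.Balaban1983to89.BlockAveragingZd
import Literature.MathematicalPhysics.QuantumFieldTheory.Balaban1983to89.B8Ineq129

/-!
# `Balaban1983to89.B8Lemma1NonAbelianRecLoops` — the loops `V(Γ ∪ [x,x′] ∪ (−Γ′) ∪ (−c))` of the RECORD's symmetric block averaging
# [Balaban1987RG1] (0.4) (centred blocks, ALL shortest staircases) READ IN THE TREE GAUGE AT THE BLOCK CENTRE: `|W − 1| ≤ ω`,
# `ω = (d−1)·s·(d·s + L)·a` (`L = 2s+1`), `|X_c| ≤ 2ω` — the (0.4)-half of [Balaban1985RegularSpaces] Lemma 1 on the `ℤᵈ` carriers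

statement-level skeleton of published theorems with citation tags; proofs where landed; nothing here is a claim about the Yang–Mills mass gap

CITATION HEADER.  [6] = T. Bałaban, *Spaces of regular gauge field configurations on a lattice and gauge fixing conditions*, Commun. Math. Phys. **99**
(1985) 75–102 [Balaban1985RegularSpaces], Lemma 1 p. 79 and its mechanism «by the same reasoning as in [3] (between (44) and (46))»; [3] = T. Bałaban,
*Averaging operations for lattice gauge theories*, Commun. Math. Phys. **98** (1985) 17–51 [Balaban1985Averaging], p. 24 l. −2 – p. 25 l. 3 «The conditions
V₀(Γ_{y,x}) = 1 imply V₀(x, x + e₁) = 1, |V₀(x, x + e₂) − 1| < |x₁ − y₁|α₀, …», (42) p. 23; [I] = T. Bałaban, *Renormalization group approach to lattice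
gauge field theories. I*, Commun. Math. Phys. **109** (1987) 249–301 [Balaban1987RG1], (0.3)–(0.4) pp. 252–253 (the contours `G(y,x)` = ALL shortest
staircases from the block CENTRE, the loop `Γ ∪ [x,x′] ∪ (−Γ′) ∪ (−c)`, the weights `L^{−d}|G(c₋,x)|⁻¹|G(c₊,x′)|⁻¹`).
Cell `pub-ymgap`, seat `pub-ymgap-dag-n05-d` g23 — «N05-REC» road (director-ym №254∕№255, plan g90 SIZING WORD 2026-08-29; LEAD PEN dag-n05-e: R0a =
`BlockAveragingZd` p690042, TOKEN RULE `N05-REC-LEAD.md` §2), item R2 = the [6] Sect. A octet for the record average; this module = the GENUINE half of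
the twin of `B8Lemma1NonAbelian` (its §1–§5: the loops of the average in the tree gauge), the Lemma-1 half is the sibling `B8Lemma1NonAbelianRec`.
`--kind proof --supports stmt-QuantumFields-20541` (K0⁷; count-neutral).

WHY A RE-PROOF (and not a re-key).  The engine's Lemma 1 (`B8Lemma1NonAbelian`, corner blocks, ONE staircase `treeWord` per block point) bounds the loops
of [3] (42) `W_{c,x} = V(Γ_{c,x})V(c)⁻¹` in the tree gauge at the corner `y`: `Γ_{c₊,x(c)}` is the TRANSLATE of `Γ_{c₋,x}`, so `|W − 1| ≤ L·a·Σ_{κ′≠κ} r_{κ′} ≤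
(d−1)(L−1)·L·a` (`norm_Wcx_sub_one_le_sharp`).  The record's loop (0.4) has TWO staircases `Γ ∈ G(c₋,x)`, `Γ′ ∈ G(c₊,x′)` of INDEPENDENT orders `σ, σ′`,
neither on the gauge tree, from the block CENTRES (`BlockAveragingZd.WZ L V q κ (r,σ,σ′)` = `hol V q (loopWord L κ (offZ L r) σ σ′)`).  The bound is
re-derived bond by bond: in the tree gauge `V^q` at the centre `q` (engine `axialFn`, the record's radial datum — `N05-REC-LEAD.md` (T3)) every bond
`⟨z, z+e_μ⟩` costs `(Σ_{κ<μ}|z_κ − q_κ|)·a` (`B8Ineq129.axial_bond_bound_box`, sign-general, REUSED), and summing along the four pieces of the loop gives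
`ω := (d−1)·s·(d·s + L)·a`, `s = (L−1)∕2`: each staircase `≤ s²·d(d−1)∕2`, the transported bond `[x,x′]` and `Γ′`'s offset `L e_κ` together
`(d−1)·s·L` (`#{i<κ} + #{i>κ} = d−1`), `−c` on the tree costs `0`.  (Brute force over all loops, d ≤ 4, L ≤ 7: the bound is ATTAINED.)  For
`a = α₀L⁻²`: `ω ≤ (d−1)(d+2)α₀∕4`, which keeps Lemma 1's printed constant `4d²` (sibling module).

WHAT IS PROVED (kernel, sorry-free; engine names kept where the statement is the twin, TOKEN RULE (T5)).
§1 NODE 00's words in the engine's letters: `axisRun_eq_seg`, `stairRuns_eq_tw`, `stairWord_eq_tw`, `wordRev_eq_revWord`, `treeWord_eq_stairRuns_reverse`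
(the engine's tree contour IS the staircase of the reversed order — the record's radial datum).  §2 centred blocks `InBlock L q x ↔ x = q + offZ L r`
(`inBlock_iff`: `|x_κ − q_κ| ≤ s`), `InPair`, the two-block box `[pairLo, pairHi] = [q − s𝟙, q + Le_κ + s𝟙]`.  §3 `walkSum` and
`norm_hol_sub_one_le_walkSum` (`|W(Γ) − 1| ≤ Σ_b |W_b − 1|`), the per-bond cost `norm_stepHol_axial_sub_one_le`, runs `walkSum_run_le`.  §4 staircases:
`stairSum`, `walkSum_seg_le`, `walkSum_stairRuns_le`, and the arithmetic ★ `stairSum_le` (`≤ a(s·(Σc + |ks|B) + s²|ks|(|ks|−1)∕2)`).  §5 `omegaC` (= `ω`),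
`sum_lt_add_sum_gt`, ★★ `norm_WZ_sub_one_le` (`|WZ − 1| ≤ ω` for EVERY `(r, σ, σ′)` under (1.7)`_{k=1}` on the two-block box).  §6 ★ `norm_XZ_le` (`|X_c| ≤ 2ω`,
`ω ≤ ½`), `norm_bavgZ_inv_le`, `norm_segRatio_sub_one_le` (`|U(c)V₀(c)⁻¹ − 1| ≤ α₁e^{3t} + e^{2t} − 1` through the record averages) — the engine's §5
with `Xavg ∕ bavg ↦ XZ ∕ bavgZ` (TOKEN RULE (T1)).

HONEST SCOPE.  (i) `U1 𝔸`-valued fields on `ℤᵈ` (engine generality, (T4)); odd `L = 2s+1` (the record's `L`); the UNGUARDED edition `bavgZ` (T1).  (ii) Only the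
`k = 1` clause of (1.7) on the plaquettes of `B(c₋) ∪ B(c₊)` is used (locality as in print p. 80).  (iii) `ω` is this module's explicit constant, not a printed
one; print's Lemma 1 has «for α₀, α₁ small».  (iv) Nothing of [I]∕[3]∕[6] beyond the displayed bookkeeping + the bond-cost summation is asserted; `HThm4Rec`
(N07's conditional premise) is UNDISCHARGED by this file; N05 ∕ N07 NOT discharged; counts unmoved; one finite 𝕋⁴ programme at fixed ε — nothing continuum ∕
ℝ⁴ ∕ OS ∕ mass gap ∕ Clay.  No `instance`, no `notation`, no `sorry`.
-/

noncomputable section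

open scoped BigOperators
open NormedSpace Finset

namespace Literature.MathematicalPhysics.QuantumFieldTheory.Balaban1983to89.B8Lemma1NonAbelianRecLoops

open B7Prop1Explicit MatrixLog BlockAveragingZd
open B8Lemma1NonAbelian (lowPart lowPart_apply lowPart_add lowPart_sub lowPart_zero lowPart_zsmul_e_of_le
  lowPart_zsmul_e_of_lt zsmul_e_apply zsmul_e_apply_self e_apply_self e_apply_of_ne l1_lowPart_eq e_nonneg
  zsmul_e_nonneg tw tw_nil tw_cons treeWord_eq_tw axial_bond_eq_sharp
  axial_treeBond_eq_one treeWord_zsmul_e hol_axial_seg_base norm_exp_le_of_norm_le exp_pow_le_one_add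
  norm_triple_sub_one_le mulCfg pert pert_mulCfg covProd norm_units_mul_sub_one_le Tfac Tfac_eq crossing_identity)
open B8Ineq129 (vec_apply axial_bond_bound_box l1_lowPart_le)
open T4Continuum (stairWord stairRuns axisRun loopWord wordRev)

-- `Site` alone would resolve to the torus sites of `Setup.lean`; re-export the `ℤᵈ` sites of `B7Prop1Explicit`.
export B7Prop1Explicit (Site)

variable {d : ℕ}

/-! ## §1 The words of (0.3)∕(0.4) in the engine's letters: runs are segments, staircases are `tw`-words -/

/-- NODE 00's run `axisRun μ k` IS the engine's segment `seg μ k` (same letters `(μ, sign k)`); private: the same list fact is stated in a Summits file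
(`…N16Step04TorusBridge`). [cite: Balaban1987RG1, (0.3) p.252] -/
private theorem axisRun_eq_seg (μ : Fin d) (k : ℤ) : axisRun μ k = seg μ k := by
  cases k with
  | ofNat n => simp [T4Continuum.axisRun]
  | negSucc n =>
    have h : ¬ (0 : ℤ) ≤ Int.negSucc n := not_le.mpr (Int.negSucc_lt_zero n)
    simp [T4Continuum.axisRun, seg_negSucc, h]

/-- The staircase through a list of axes is the engine's restricted tree word `tw` over that list. [cite: Balaban1987RG1, (0.3) p.252] -/
theorem stairRuns_eq_tw (n : Site d) : ∀ ks : List (Fin d), stairRuns n ks = tw ks n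
  | [] => by simp [T4Continuum.stairRuns, tw]
  | a :: ks => by rw [T4Continuum.stairRuns, tw_cons, axisRun_eq_seg, stairRuns_eq_tw n ks]

/-- **`Γ ∈ G(y, x)` as a `tw`-word**: `stairWord σ n = tw [σ 0, …, σ (d−1)] n`. [cite: Balaban1987RG1, (0.3) p.252] -/
theorem stairWord_eq_tw (σ : Equiv.Perm (Fin d)) (n : Site d) :
    stairWord σ n = tw ((List.finRange d).map σ) n :=
  stairRuns_eq_tw n _

/-- NODE 00's reversed word is the engine's `revWord` (same letter flip); private: also stated in a Summits file (`…N16Step04TorusBridge`).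
[cite: Balaban1985Averaging, (9) p.18 (bookkeeping)] -/
private theorem wordRev_eq_revWord (w : List (Letter d)) : wordRev w = revWord w := rfl

/-- **The engine's tree contour is the staircase of the REVERSED order** (B5 (1.7): last coordinate first):
`treeWord v = tw [d−1, …, 0] v` — the ONE staircase the record's radial axial gauge uses (`Balaban3D/Carriers/RadialContour`,
`coordsDesc`), here only re-read. [cite: Balaban1984PropagatorsI, (1.7) p.18] -/
theorem treeWord_eq_stairRuns_reverse (v : Site d) : treeWord v = stairRuns v (List.finRange d).reverse := by
  rw [treeWord_eq_tw, stairRuns_eq_tw]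

/-! ## §2 Centred blocks `B(q) = q + [−s, s]ᵈ` (`L = 2s + 1`) and the two-block box of a coarse bond -/

/-- `x ∈ B(q)`: `x` is a point of the CENTRED block based at `q` — `x = q + offZ L r` for an offset `r ∈ {0,…,L−1}ᵈ`
([Balaban1987RG1] p. 252 «a block … with a center at y»; engine: `B8Lemma1Lattice.InBlock`, corner blocks). [cite: Balaban1987RG1, (0.3) p.252] -/
def InBlock (L : ℕ) (q x : Site d) : Prop := ∃ r : Fin d → Fin L, x = q + offZ L r

/-- For odd `L = 2s+1`: `x ∈ B(q) ↔ |x_κ − q_κ| ≤ s` for every coordinate. [cite: Balaban1987RG1, (0.3) p.252] -/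
theorem inBlock_iff {L s : ℕ} (hL : L = 2 * s + 1) (q x : Site d) :
    InBlock L q x ↔ ∀ κ, -(s : ℤ) ≤ x κ - q κ ∧ x κ - q κ ≤ s := by
  have hs : (L - 1) / 2 = s := by omega
  constructor
  · rintro ⟨r, rfl⟩ κ
    have hr := (r κ).isLt
    simp only [Pi.add_apply, offZ_apply, hs, add_sub_cancel_left]
    constructor <;> omega
  · intro h
    refine ⟨fun κ => ⟨(x κ - q κ + s).toNat, by have := h κ; omega⟩, ?_⟩
    funext κ
    have := h κ
    simp only [Pi.add_apply, offZ_apply, hs]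
    omega

/-- `x ∈ B(c₋) ∪ B(c₊)` for the coarse bond `c = ⟨q, q + Le_κ⟩` based at the block centre `q`. [cite: Balaban1985RegularSpaces, (1.23) p.79] -/
def InPair (L : ℕ) (q : Site d) (κ : Fin d) (x : Site d) : Prop :=
  InBlock L q x ∨ InBlock L (q + (L : ℤ) • e κ) x

/-- The constant vector `(L−1)∕2 · 𝟙` (half the block side, odd `L`). [cite: Balaban1987RG1, (0.3) p.252] -/
def halfVec (L : ℕ) : Site d := fun _ => (((L - 1) / 2 : ℕ) : ℤ)

/-- Lower corner of the box `B(c₋) ∪ B(c₊) = [q − s𝟙, q + Le_κ + s𝟙]`. [cite: Balaban1985RegularSpaces, (1.23) p.79] -/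
def pairLo (L : ℕ) (q : Site d) : Site d := q - halfVec L

/-- Upper corner of the box `B(c₋) ∪ B(c₊) = [q − s𝟙, q + Le_κ + s𝟙]`. [cite: Balaban1985RegularSpaces, (1.23) p.79] -/
def pairHi (L : ℕ) (q : Site d) (κ : Fin d) : Site d := q + (L : ℤ) • e κ + halfVec L

/-- Coordinates of the box `[q − s𝟙, q + Le_κ + s𝟙]`. [cite: Balaban1985RegularSpaces, (1.23) p.79 (bookkeeping)] -/
theorem mem_pairBox_iff {L s : ℕ} (hL : L = 2 * s + 1) (q : Site d) (κ : Fin d) (x : Site d) :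
    (pairLo L q ≤ x ∧ x ≤ pairHi L q κ) ↔
      ∀ i, -(s : ℤ) ≤ x i - q i ∧ x i - q i ≤ (if i = κ then (L : ℤ) else 0) + s := by
  have hs : (L - 1) / 2 = s := by omega
  simp only [Pi.le_def, pairLo, pairHi, halfVec, Pi.sub_apply, Pi.add_apply, zsmul_e_apply, hs]
  constructor
  · rintro ⟨h1, h2⟩ i
    have := h1 i; have := h2 i
    constructor <;> omega
  · intro h
    constructor <;> intro i <;> have := h i <;> omega

/-- The centre `q` lies in the box. [cite: Balaban1985RegularSpaces, (1.23) p.79 (bookkeeping)] -/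
theorem base_mem_pairBox {L s : ℕ} (hL : L = 2 * s + 1) (q : Site d) (κ : Fin d) :
    pairLo L q ≤ q ∧ q ≤ pairHi L q κ := by
  rw [mem_pairBox_iff hL]
  intro i
  simp only [sub_self]
  constructor
  · omega
  · split_ifs <;> omega

/-- A point `x` with `|x_i − q_i| ≤ s` off `κ` and `−s ≤ x_κ − q_κ ≤ L + s` lies in the box. [cite: Balaban1985RegularSpaces, (1.23) p.79 (bookkeeping)] -/
theorem mem_pairBox_of {L s : ℕ} (hL : L = 2 * s + 1) (q : Site d) (κ : Fin d) (x : Site d)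
    (h : ∀ i, -(s : ℤ) ≤ x i - q i ∧ (i ≠ κ → x i - q i ≤ s) ∧ (i = κ → x i - q i ≤ (L : ℤ) + s)) :
    pairLo L q ≤ x ∧ x ≤ pairHi L q κ := by
  rw [mem_pairBox_iff hL]
  intro i
  obtain ⟨h1, h2, h3⟩ := h i
  refine ⟨h1, ?_⟩
  split_ifs with hi
  · exact h3 hi
  · simpa using h2 hi


/-! ## §3 Walks in the tree gauge at the centre: per-bond cost `l1 (lowPart μ (z − q))·a`, runs, staircases -/

section Walks

variable {𝔸 : Type*} [NormedRing 𝔸] [NormOneClass 𝔸]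

/-- **The walk sum**: the sum over the letters of a word, read from `p`, of `|W_b − 1|` for the bond variable the letter
traverses (`stepHol`). [cite: Balaban1985Averaging, (9) p.18 (bookkeeping)] -/
def walkSum (W : Site d → Fin d → 𝔸ˣ) : Site d → List (Letter d) → ℝ
  | _, [] => 0
  | p, l :: w => ‖((stepHol W p l : 𝔸ˣ) : 𝔸) - 1‖ + walkSum W (p + l.vec) w

omit [NormOneClass 𝔸] in
/-- `walkSum_nil` — bookkeeping. [cite: Balaban1985Averaging, (9) p.18 (bookkeeping)] -/
@[simp] theorem walkSum_nil (W : Site d → Fin d → 𝔸ˣ) (p : Site d) : walkSum W p [] = 0 := rfl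

omit [NormOneClass 𝔸] in
/-- `walkSum_cons` — bookkeeping. [cite: Balaban1985Averaging, (9) p.18 (bookkeeping)] -/
theorem walkSum_cons (W : Site d → Fin d → 𝔸ˣ) (p : Site d) (l : Letter d) (w : List (Letter d)) :
    walkSum W p (l :: w) = ‖((stepHol W p l : 𝔸ˣ) : 𝔸) - 1‖ + walkSum W (p + l.vec) w := rfl

omit [NormOneClass 𝔸] in
/-- `walkSum_append`: the walk sum is additive along concatenation. [cite: Balaban1985Averaging, (9) p.18 (bookkeeping)] -/
theorem walkSum_append (W : Site d → Fin d → 𝔸ˣ) : ∀ (p : Site d) (w₁ w₂ : List (Letter d)),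
    walkSum W p (w₁ ++ w₂) = walkSum W p w₁ + walkSum W (p + disp w₁) w₂
  | p, [], w₂ => by simp
  | p, l :: w₁, w₂ => by
    rw [List.cons_append, walkSum_cons, walkSum_cons, walkSum_append W (p + l.vec) w₁ w₂, disp_cons, add_assoc,
      add_assoc]

omit [NormOneClass 𝔸] in
/-- `walkSum_nonneg` — bookkeeping. [cite: Balaban1985Averaging, (9) p.18 (bookkeeping)] -/
theorem walkSum_nonneg (W : Site d → Fin d → 𝔸ˣ) : ∀ (p : Site d) (w : List (Letter d)), 0 ≤ walkSum W p w
  | _, [] => le_rfl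
  | _, _ :: w => add_nonneg (norm_nonneg _) (walkSum_nonneg W _ w)

/-- **`|W(Γ) − 1| ≤ Σ_{b ⊂ Γ} |W_b − 1|`** for a `U1`-valued bond field (`‖gh − 1‖ ≤ ‖g − 1‖ + ‖h − 1‖`, `‖g‖ ≤ 1`). [cite: Balaban1985Averaging, (9) p.18 (bookkeeping)] -/
theorem norm_hol_sub_one_le_walkSum {W : Site d → Fin d → 𝔸ˣ} (hW : ∀ x κ, W x κ ∈ U1 𝔸) :
    ∀ (p : Site d) (w : List (Letter d)), ‖((hol W p w : 𝔸ˣ) : 𝔸) - 1‖ ≤ walkSum W p w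
  | p, [] => by simp
  | p, l :: w => by
    rw [hol_cons, Units.val_mul, walkSum_cons]
    have h1 : ‖((stepHol W p l : 𝔸ˣ) : 𝔸)‖ ≤ 1 := (mem_U1.mp (stepHol_mem hW p l)).1
    calc _ ≤ _ + _ := B8Ineq170.norm_mul_sub_one_le_of_norm_le_one h1
      _ ≤ _ := add_le_add le_rfl (norm_hol_sub_one_le_walkSum hW _ w)

omit [NormOneClass 𝔸] in
/-- `lowPart μ (e_μ) = 0` — bookkeeping. [cite: Balaban1985Averaging, (9) p.18 (bookkeeping)] -/
theorem lowPart_e_self (μ : Fin d) : lowPart μ (e μ : Site d) = 0 := by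
  simpa using lowPart_zsmul_e_of_le (le_refl μ) (1 : ℤ)

/-- **The cost of ONE bond in the tree gauge at `q`** ([Balaban1985Averaging] p. 24 l. −2 – p. 25 l. 3, sign-general form
`B8Ineq129.axial_bond_bound_box`): the letter `l = ±e_μ` read at `z` traverses a bond whose variable in the gauge `V^q` satisfies
`|V^q_b − 1| ≤ (Σ_{κ<μ} |z_κ − q_κ|)·a`, provided `z`, `z + l`, `q` lie in a box on whose plaquettes `|V(∂p) − 1| ≤ a`.
[cite: Balaban1985Averaging, pp.24–25; Balaban1985RegularSpaces, p.79] -/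
theorem norm_stepHol_axial_sub_one_le (V : Site d → Fin d → 𝔸ˣ) (hV : ∀ x κ, V x κ ∈ U1 𝔸) {lo hi : Site d}
    {a : ℝ} (hP : B8Lemma1NonAbelian.PlaqSmall V lo hi a) (ha : 0 ≤ a) (q : Site d) (hq : lo ≤ q) (hq' : q ≤ hi) (z : Site d)
    (l : Letter d) (hz : lo ≤ z) (hz' : z ≤ hi) (hzl : lo ≤ z + l.vec) (hzl' : z + l.vec ≤ hi) :
    ‖((stepHol (gaugeAct (axialFn V q) V) z l : 𝔸ˣ) : 𝔸) - 1‖ ≤ l1 (lowPart l.1 (z - q)) * a := by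
  obtain ⟨μ, b⟩ := l
  cases b
  · -- backward letter: the bond `⟨z − e_μ, z⟩`, traversed backwards
    rw [stepHol_false]
    have hzm : lo ≤ z - e μ := by simpa [sub_eq_add_neg] using hzl
    have hb := (axial_bond_bound_box V hV hP ha q (z - e μ) μ hzm hq (by simpa using hz') hq').1
    have hlp : lowPart μ (z - e μ - q) = lowPart μ (z - q) := by
      rw [show z - e μ - q = (z - q) - e μ by abel, lowPart_sub, lowPart_e_self, sub_zero]
    rw [hlp] at hb
    exact (norm_inv_sub_one_le (gaugeAct_mem hV (axialFn_mem hV q) _ _)).trans hb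
  · rw [stepHol_true]
    exact (axial_bond_bound_box V hV hP ha q z μ hz hq (by simpa using hzl') hq').1

omit [NormOneClass 𝔸] in
/-- One step along `±e_μ` stays in a box containing both ends of the run (order-convexity of boxes). [cite: Balaban1985Averaging, (9) p.18 (bookkeeping)] -/
theorem mem_box_step {lo hi p : Site d} {μ : Fin d} {b : Bool} (n : ℕ) (hp : lo ≤ p) (hp' : p ≤ hi)
    (hpn : lo ≤ p + ((n + 1 : ℕ) : ℤ) • Letter.vec ((μ, b) : Letter d))
    (hpn' : p + ((n + 1 : ℕ) : ℤ) • Letter.vec ((μ, b) : Letter d) ≤ hi) :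
    lo ≤ p + Letter.vec ((μ, b) : Letter d) ∧ p + Letter.vec ((μ, b) : Letter d) ≤ hi := by
  constructor <;> intro i <;> have h1 := hp i <;> have h2 := hp' i <;> have h3 := hpn i <;> have h4 := hpn' i <;>
    simp only [Pi.add_apply, Pi.smul_apply, smul_eq_mul, vec_apply] at h1 h2 h3 h4 ⊢ <;>
    split_ifs at h3 h4 ⊢ <;> push_cast at h3 h4 ⊢ <;> nlinarith

/-- **The cost of a RUN** `n` letters `±e_μ` from `p` in the tree gauge at `q`: every bond of the run has the same coordinates below
`μ` as `p`, so the walk sum is `≤ n · (Σ_{κ<μ}|p_κ − q_κ|) · a`. [cite: Balaban1985Averaging, pp.24–25] -/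
theorem walkSum_run_le (V : Site d → Fin d → 𝔸ˣ) (hV : ∀ x κ, V x κ ∈ U1 𝔸) {lo hi : Site d} {a : ℝ}
    (hP : B8Lemma1NonAbelian.PlaqSmall V lo hi a) (ha : 0 ≤ a) (q : Site d) (hq : lo ≤ q) (hq' : q ≤ hi) (μ : Fin d) (b : Bool) :
    ∀ (n : ℕ) (p : Site d), lo ≤ p → p ≤ hi → lo ≤ p + (n : ℤ) • Letter.vec ((μ, b) : Letter d) →
      p + (n : ℤ) • Letter.vec ((μ, b) : Letter d) ≤ hi →
      walkSum (gaugeAct (axialFn V q) V) p (List.replicate n (μ, b)) ≤ (n : ℝ) * (l1 (lowPart μ (p - q)) * a)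
  | 0, p, _, _, _, _ => by simp
  | n + 1, p, hp, hp', hpn, hpn' => by
    obtain ⟨hv1, hv2⟩ := mem_box_step n hp hp' hpn hpn'
    have hstep := norm_stepHol_axial_sub_one_le V hV hP ha q hq hq' p (μ, b) hp hp' hv1 hv2
    have hshift : p + Letter.vec ((μ, b) : Letter d) + (n : ℤ) • Letter.vec ((μ, b) : Letter d) =
        p + ((n + 1 : ℕ) : ℤ) • Letter.vec ((μ, b) : Letter d) := by
      rw [add_assoc, Nat.cast_succ, add_smul, one_smul, add_comm ((n : ℤ) • _)]
    have ih := walkSum_run_le V hV hP ha q hq hq' μ b n (p + Letter.vec (μ, b)) hv1 hv2 (by rw [hshift]; exact hpn)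
      (by rw [hshift]; exact hpn')
    have hlp : lowPart μ (p + Letter.vec ((μ, b) : Letter d) - q) = lowPart μ (p - q) := by
      rw [show p + Letter.vec ((μ, b) : Letter d) - q = (p - q) + Letter.vec ((μ, b) : Letter d) by abel, lowPart_add]
      cases b
      · rw [Letter.vec_false, show (-e μ : Site d) = (-1 : ℤ) • e μ by simp, lowPart_zsmul_e_of_le le_rfl, add_zero]
      · rw [Letter.vec_true, lowPart_e_self, add_zero]
    rw [hlp] at ih
    rw [List.replicate_succ, walkSum_cons]
    have hstep' : ‖((stepHol (gaugeAct (axialFn V q) V) p (μ, b) : 𝔸ˣ) : 𝔸) - 1‖ ≤ l1 (lowPart μ (p - q)) * a := hstep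
    push_cast
    linarith

end Walks


/-! ## §4 Staircase walks: `Σ_{bonds of Γ_σ} (Σ_{κ<μ}|z_κ − q_κ|)·a` and its bound `a·(s·Σc + s²·d(d−1)∕2)` -/

/-- **The staircase cost**: for the staircase of `n` through the axes `ks` read from `p`, the sum over its runs of
`|n_μ| · (Σ_{κ<μ} |p^{(μ)}_κ − q_κ|) · a`, `p^{(μ)}` the corner at which the `μ`-run starts. [cite: Balaban1987RG1, (0.3) p.252] -/
def stairSum (q : Site d) (a : ℝ) (n : Site d) : Site d → List (Fin d) → ℝ
  | _, [] => 0
  | p, μ :: ks => ((n μ).natAbs : ℝ) * (l1 (lowPart μ (p - q)) * a) + stairSum q a n (p + n μ • e μ) ks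

/-- `stairSum_nil` — bookkeeping. [cite: Balaban1987RG1, (0.3) p.252 (bookkeeping)] -/
@[simp] theorem stairSum_nil (q : Site d) (a : ℝ) (n p : Site d) : stairSum q a n p [] = 0 := rfl

/-- `stairSum_cons` — bookkeeping. [cite: Balaban1987RG1, (0.3) p.252 (bookkeeping)] -/
theorem stairSum_cons (q : Site d) (a : ℝ) (n p : Site d) (μ : Fin d) (ks : List (Fin d)) :
    stairSum q a n p (μ :: ks) =
      ((n μ).natAbs : ℝ) * (l1 (lowPart μ (p - q)) * a) + stairSum q a n (p + n μ • e μ) ks := rfl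

/-- Moving one coordinate inside a box (order-convexity). [cite: Balaban1987RG1, (0.3) p.252 (bookkeeping)] -/
theorem mem_box_coord {lo hi p : Site d} (hp : lo ≤ p) (hp' : p ≤ hi) (μ : Fin d) (t : ℤ)
    (h1 : lo μ ≤ p μ + t) (h2 : p μ + t ≤ hi μ) : lo ≤ p + t • e μ ∧ p + t • e μ ≤ hi := by
  constructor <;> intro i <;> have := hp i <;> have := hp' i <;>
    simp only [Pi.add_apply, zsmul_e_apply] <;> split_ifs with h <;> (try subst h) <;> simp <;> assumption

/-- **THE STAIRCASE COST BOUND** (pure arithmetic): if `|n_i| ≤ s` for all `i` and `Σ_{κ<μ}|p_κ − q_κ| ≤ c_μ + B` for the axes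
`μ` of the list, then `stairSum ≤ a·(s·(Σ_{μ∈ks} c_μ + |ks|·B) + s²·|ks|(|ks|−1)∕2)` — each run shifts the later runs' base
points by at most `s` in one coordinate. [cite: Balaban1987RG1, (0.3) p.252] -/
theorem stairSum_le (q : Site d) {a : ℝ} (ha : 0 ≤ a) (n : Site d) {s : ℕ} (hn : ∀ i, (n i).natAbs ≤ s)
    (c : Fin d → ℝ) : ∀ (ks : List (Fin d)) (p : Site d) (B : ℝ),
      (∀ μ ∈ ks, (l1 (lowPart μ (p - q)) : ℝ) ≤ c μ + B) →
      stairSum q a n p ks ≤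
        a * ((s : ℝ) * ((ks.map c).sum + ks.length * B) + (s : ℝ) ^ 2 * (ks.length * ((ks.length : ℝ) - 1) / 2))
  | [], p, B, _ => by simp
  | μ :: ks, p, B, h => by
    rw [stairSum_cons, List.map_cons, List.sum_cons, List.length_cons, Nat.cast_succ]
    have hμ := h μ (by simp)
    have hnμ : ((n μ).natAbs : ℝ) ≤ s := by exact_mod_cast hn μ
    have hl1 : (0 : ℝ) ≤ l1 (lowPart μ (p - q)) := Nat.cast_nonneg _
    have htail : ∀ κ ∈ ks, (l1 (lowPart κ (p + n μ • e μ - q)) : ℝ) ≤ c κ + (B + s) := by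
      intro κ hκ
      have e1 : lowPart κ (p + n μ • e μ - q) = lowPart κ (p - q) + lowPart κ (n μ • e μ) := by
        rw [show p + n μ • e μ - q = (p - q) + n μ • e μ by abel, lowPart_add]
      have e2 : l1 (lowPart κ (p + n μ • e μ - q)) ≤ l1 (lowPart κ (p - q)) + s := by
        rw [e1]
        refine (l1_add_le _ _).trans (add_le_add le_rfl ?_)
        exact (l1_lowPart_le κ _).trans (by rw [l1_zsmul_e]; exact hn μ)
      have e3 : (l1 (lowPart κ (p + n μ • e μ - q)) : ℝ) ≤ l1 (lowPart κ (p - q)) + s := by exact_mod_cast e2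
      linarith [h κ (List.mem_cons_of_mem μ hκ)]
    have ih := stairSum_le q ha n hn c ks (p + n μ • e μ) (B + s) htail
    have hhead : ((n μ).natAbs : ℝ) * (l1 (lowPart μ (p - q)) * a) ≤ a * ((s : ℝ) * (c μ + B)) := by
      have : ((n μ).natAbs : ℝ) * (l1 (lowPart μ (p - q)) : ℝ) ≤ (s : ℝ) * (c μ + B) :=
        mul_le_mul hnμ hμ hl1 (Nat.cast_nonneg _)
      nlinarith
    have key : a * ((s : ℝ) * (c μ + B)) +
        a * ((s : ℝ) * ((ks.map c).sum + ks.length * (B + s)) + (s : ℝ) ^ 2 * (ks.length * ((ks.length : ℝ) - 1) / 2)) =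
        a * ((s : ℝ) * ((c μ + (ks.map c).sum) + ((ks.length : ℝ) + 1) * B) +
          (s : ℝ) ^ 2 * (((ks.length : ℝ) + 1) * ((ks.length : ℝ) + 1 - 1) / 2)) := by ring
    linarith

section Stairs

variable {𝔸 : Type*} [NormedRing 𝔸] [NormOneClass 𝔸]

/-- The walk sum of a segment `seg μ k` (both signs of `k`) from `p`, both ends in the box: `≤ |k|·(Σ_{κ<μ}|p_κ − q_κ|)·a`.
[cite: Balaban1985Averaging, pp.24–25] -/
theorem walkSum_seg_le (V : Site d → Fin d → 𝔸ˣ) (hV : ∀ x κ, V x κ ∈ U1 𝔸) {lo hi : Site d} {a : ℝ}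
    (hP : B8Lemma1NonAbelian.PlaqSmall V lo hi a) (ha : 0 ≤ a) (q : Site d) (hq : lo ≤ q) (hq' : q ≤ hi) (μ : Fin d)
    (k : ℤ) (p : Site d) (hp : lo ≤ p) (hp' : p ≤ hi) (hpk : lo ≤ p + k • e μ) (hpk' : p + k • e μ ≤ hi) :
    walkSum (gaugeAct (axialFn V q) V) p (seg μ k) ≤ (k.natAbs : ℝ) * (l1 (lowPart μ (p - q)) * a) := by
  cases k with
  | ofNat m =>
    have hv : (m : ℤ) • Letter.vec ((μ, true) : Letter d) = (Int.ofNat m) • e μ := by simp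
    have h := walkSum_run_le V hV hP ha q hq hq' μ true m p hp hp' (by rw [hv]; exact hpk) (by rw [hv]; exact hpk')
    simpa using h
  | negSucc m =>
    have hv : ((m + 1 : ℕ) : ℤ) • Letter.vec ((μ, false) : Letter d) = (Int.negSucc m) • e μ := by
      rw [Letter.vec_false, smul_neg, ← neg_smul, Int.negSucc_eq]; push_cast; ring_nf
    have h := walkSum_run_le V hV hP ha q hq hq' μ false (m + 1) p hp hp' (by rw [hv]; exact hpk)
      (by rw [hv]; exact hpk')
    rw [seg_negSucc, Int.natAbs_negSucc]
    exact h

/-- **THE STAIRCASE WALK**: for the staircase of `n` through a duplicate-free list of axes `ks`, read from `p` in the tree gauge at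
`q`, with `p` and all the run end-points in the box: walk sum `≤ stairSum`. [cite: Balaban1987RG1, (0.3) p.252; Balaban1985Averaging, pp.24–25] -/
theorem walkSum_stairRuns_le (V : Site d → Fin d → 𝔸ˣ) (hV : ∀ x κ, V x κ ∈ U1 𝔸) {lo hi : Site d} {a : ℝ}
    (hP : B8Lemma1NonAbelian.PlaqSmall V lo hi a) (ha : 0 ≤ a) (q : Site d) (hq : lo ≤ q) (hq' : q ≤ hi) (n : Site d) :
    ∀ (ks : List (Fin d)), ks.Nodup → ∀ (p : Site d), lo ≤ p → p ≤ hi →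
      (∀ i ∈ ks, lo i ≤ p i + n i ∧ p i + n i ≤ hi i) →
      walkSum (gaugeAct (axialFn V q) V) p (stairRuns n ks) ≤ stairSum q a n p ks
  | [], _, p, _, _, _ => by simp [T4Continuum.stairRuns]
  | μ :: ks, hnd, p, hp, hp', hbox => by
    have hμ : μ ∉ ks := (List.nodup_cons.mp hnd).1
    have hnd' : ks.Nodup := (List.nodup_cons.mp hnd).2
    obtain ⟨hpn, hpn'⟩ := mem_box_coord hp hp' μ (n μ) (hbox μ (by simp)).1 (hbox μ (by simp)).2
    rw [T4Continuum.stairRuns, walkSum_append, axisRun_eq_seg, disp_seg, stairSum_cons]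
    refine add_le_add (walkSum_seg_le V hV hP ha q hq hq' μ (n μ) p hp hp' hpn hpn') ?_
    refine walkSum_stairRuns_le V hV hP ha q hq hq' n ks hnd' (p + n μ • e μ) hpn hpn' fun i hi => ?_
    have hne : i ≠ μ := fun h => hμ (h ▸ hi)
    have := hbox i (List.mem_cons_of_mem μ hi)
    simpa [e_apply, hne] using this

end Stairs


/-! ## §5 The loops of (0.4) in the tree gauge at the centre: `|V(Γ ∪ [x,x′] ∪ (−Γ′) ∪ (−c)) − 1| ≤ ω`,
`ω := (d−1)·s·(d·s + L)·a`, `s = (L−1)∕2` -/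

/-- **The loop constant of the record average**: `ω = (d−1)·s·(d·s + L)·a`, `s = (L−1)∕2` — the exact worst case of the sum of the
bond costs `Σ_{κ<μ}|z_κ − q_κ|` over the loop `Γ ∪ [x,x′] ∪ (−Γ′) ∪ (−c)` of (0.4) (the two staircases cost `≤ s²·d(d−1)∕2` each,
the transported bond and the far staircase together `(d−1)·s·L`, the straight line `c` lies on the gauge tree and costs `0`); the
engine's one-staircase loop `Γ_{c,x} ∪ (−Γ_c)` has `ω = (d−1)(L−1)·L·a` (`B8Lemma1NonAbelian.omegaC`). For `a = α₀L⁻²`: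
`ω ≤ (d−1)(d+2)∕4 · α₀`. [cite: Balaban1987RG1, (0.4) p.253; Balaban1985RegularSpaces, Lemma 1 p.79] -/
def omegaC (d L : ℕ) (a : ℝ) : ℝ :=
  ((d : ℝ) - 1) * (((L : ℝ) - 1) / 2) * ((d : ℝ) * (((L : ℝ) - 1) / 2) + L) * a

/-- `omegaC_nonneg` — bookkeeping. [cite: Balaban1985RegularSpaces, Lemma 1 p.79 (bookkeeping)] -/
theorem omegaC_nonneg {L : ℕ} (hL : 1 ≤ L) (hd : 1 ≤ d) {a : ℝ} (ha : 0 ≤ a) : 0 ≤ omegaC d L a := by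
  unfold omegaC
  have h1 : (1 : ℝ) ≤ L := by exact_mod_cast hL
  have h2 : (1 : ℝ) ≤ d := by exact_mod_cast hd
  have h3 : 0 ≤ ((L : ℝ) - 1) / 2 := by linarith
  have h4 : 0 ≤ (d : ℝ) - 1 := by linarith
  positivity

/-- Counting: `#{i < κ} + #{κ < i} = d − 1`. [cite: Balaban1985RegularSpaces, Lemma 1 p.79 (bookkeeping)] -/
theorem sum_lt_add_sum_gt (κ : Fin d) :
    (∑ i : Fin d, (if i < κ then (1 : ℝ) else 0)) + ∑ i : Fin d, (if κ < i then (1 : ℝ) else 0) = (d : ℝ) - 1 := by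
  rw [← Finset.sum_add_distrib]
  have h : ∀ i : Fin d, ((if i < κ then (1 : ℝ) else 0) + if κ < i then (1 : ℝ) else 0) = 1 - if i = κ then 1 else 0 := by
    intro i
    rcases lt_trichotomy i κ with hlt | heq | hgt
    · simp [hlt, ne_of_lt hlt, lt_asymm hlt]
    · simp [heq]
    · simp [hgt, ne_of_gt hgt, lt_asymm hgt]
  rw [Finset.sum_congr rfl fun i _ => h i, Finset.sum_sub_distrib, Finset.sum_const, Finset.card_univ,
    Fintype.card_fin, nsmul_eq_mul, mul_one, Finset.sum_ite_eq' Finset.univ κ, if_pos (Finset.mem_univ κ)]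

/-- `Σ_{i<κ} |n_i| ≤ s·#{i < κ}` for `|n_i| ≤ s`. [cite: Balaban1987RG1, (0.3) p.252 (bookkeeping)] -/
theorem l1_lowPart_le_mul {n : Site d} {s : ℕ} (hn : ∀ i, (n i).natAbs ≤ s) (κ : Fin d) :
    (l1 (lowPart κ n) : ℝ) ≤ (s : ℝ) * ∑ i : Fin d, (if i < κ then (1 : ℝ) else 0) := by
  rw [l1_lowPart_eq, Nat.cast_sum, Finset.mul_sum]
  refine Finset.sum_le_sum fun i _ => ?_
  by_cases h : i < κ
  · rw [if_pos h, if_pos h, mul_one]; exact_mod_cast hn i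
  · rw [if_neg h, if_neg h, mul_zero, Nat.cast_zero]

/-- `Σ_{i<μ} |(L e_κ)_i| = L·[κ < μ]`. [cite: Balaban1985Averaging, (9) p.18 (bookkeeping)] -/
theorem l1_lowPart_smul_e (L : ℕ) (κ μ : Fin d) :
    (l1 (lowPart μ ((L : ℤ) • e κ : Site d)) : ℝ) = (L : ℝ) * (if κ < μ then (1 : ℝ) else 0) := by
  split_ifs with h
  · rw [lowPart_zsmul_e_of_lt h, l1_zsmul_e]; simp
  · rw [lowPart_zsmul_e_of_le (not_lt.mp h)]; simp [l1]

section Loops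

variable {𝔸 : Type*} [NormedRing 𝔸] [NormOneClass 𝔸]

/-- The staircase index list `[σ 0, …, σ (d−1)]` is duplicate-free and has length `d`; sums over it are sums over all axes. [cite: Balaban1987RG1, (0.3) p.252 (bookkeeping)] -/
theorem perm_list_facts (σ : Equiv.Perm (Fin d)) (c : Fin d → ℝ) :
    ((List.finRange d).map σ).Nodup ∧ ((List.finRange d).map σ).length = d ∧
      (((List.finRange d).map σ).map c).sum = ∑ μ : Fin d, c μ := by
  refine ⟨(List.nodup_finRange d).map σ.injective, by simp, ?_⟩
  rw [List.map_map, ← Fin.sum_univ_def]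
  exact Equiv.sum_comp σ c

/-- **THE LOOPS OF (0.4) IN THE REGION OF CONTROL**: for odd `L = 2s+1`, a `U1`-valued `V` with `|V(∂p) − 1| ≤ a` on the plaquettes of
the two-block box `[q − s𝟙, q + Le_κ + s𝟙]` (`B(c₋) ∪ B(c₊)`, both blocks CENTRED), every loop variable of the record average at the
coarse bond `c = ⟨q, q + Le_κ⟩` obeys `|V(Γ ∪ [x,x′] ∪ (−Γ′) ∪ (−c)) − 1| ≤ ω = (d−1)·s·(d·s + L)·a` — for EVERY pair of staircase
orders `σ, σ′` and every block point `x` (read in the tree gauge at `q`: `Γ`, `Γ′` cost `≤ s²d(d−1)∕2` each, `[x,x′]` and `Γ′`'s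
offset `L e_κ` together `(d−1)sL`, `−c` is on the tree). [cite: Balaban1987RG1, (0.4) p.253; Balaban1985RegularSpaces, Lemma 1 p.79; Balaban1985Averaging, pp.24–25] -/
theorem norm_WZ_sub_one_le {L s : ℕ} (hL : L = 2 * s + 1) (V : Site d → Fin d → 𝔸ˣ) (hV : ∀ x κ, V x κ ∈ U1 𝔸)
    {lo hi : Site d} {a : ℝ} (hP : B8Lemma1NonAbelian.PlaqSmall V lo hi a) (ha : 0 ≤ a) (q : Site d) (κ : Fin d)
    (hlo : lo ≤ pairLo L q) (hhi : pairHi L q κ ≤ hi) (i : IdxZ d L) :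
    ‖((WZ L V q κ i : 𝔸ˣ) : 𝔸) - 1‖ ≤ omegaC d L a := by
  obtain ⟨r, σ, σ'⟩ := i
  set n : Site d := offZ L r with hn
  set V₀ := gaugeAct (axialFn V q) V with hV₀
  have hV₀m : ∀ x μ, V₀ x μ ∈ U1 𝔸 := gaugeAct_mem hV (axialFn_mem hV q)
  have hns : ∀ j, (n j).natAbs ≤ s := natAbs_offZ_le hL r
  have hnb : ∀ j, -(s : ℤ) ≤ n j ∧ n j ≤ s := fun j => by have := hns j; omega
  -- box memberships
  have mem : ∀ x : Site d, (pairLo L q ≤ x ∧ x ≤ pairHi L q κ) → lo ≤ x ∧ x ≤ hi :=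
    fun x h => ⟨hlo.trans h.1, h.2.trans hhi⟩
  have hLz : (0 : ℤ) ≤ L := by positivity
  have hq := mem q (base_mem_pairBox hL q κ)
  have hqn := mem (q + n) (mem_pairBox_of hL q κ _ fun j => by
    have := hnb j; simp only [Pi.add_apply, add_sub_cancel_left]; refine ⟨this.1, fun _ => this.2, fun _ => ?_⟩; omega)
  have hqnL := mem (q + n + (L : ℤ) • e κ) (mem_pairBox_of hL q κ _ fun j => by
    have := hnb j
    simp only [Pi.add_apply, zsmul_e_apply]
    refine ⟨by split_ifs <;> omega, fun hj => ?_, fun hj => ?_⟩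
    · rw [if_neg hj]; omega
    · rw [if_pos hj]; omega)
  have hqL := mem (q + (L : ℤ) • e κ) (mem_pairBox_of hL q κ _ fun j => by
    simp only [Pi.add_apply, zsmul_e_apply]
    refine ⟨by split_ifs <;> omega, fun hj => ?_, fun hj => ?_⟩
    · rw [if_neg hj]; omega
    · rw [if_pos hj]; omega)
  have hqLn := mem (q + (L : ℤ) • e κ + n) (mem_pairBox_of hL q κ _ fun j => by
    have := hnb j
    simp only [Pi.add_apply, zsmul_e_apply]
    refine ⟨by split_ifs <;> omega, fun hj => ?_, fun hj => ?_⟩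
    · rw [if_neg hj]; omega
    · rw [if_pos hj]; omega)
  -- the loop variable read in the tree gauge at `q` (closed loop, `v₀(q) = 1`)
  have h0 : WZ L V q κ (r, σ, σ') = WZ L V₀ q κ (r, σ, σ') := by
    rw [hV₀, WZ_gaugeAct]; simp [axialFn]
  -- the four pieces
  obtain ⟨hndσ, hlenσ, hsumσ⟩ := perm_list_facts σ (fun _ => (0 : ℝ))
  obtain ⟨hndσ', hlenσ', hsumσ'⟩ := perm_list_facts σ' (fun μ => (L : ℝ) * (if κ < μ then (1 : ℝ) else 0))
  have hA : ‖((hol V₀ q (stairWord σ n) : 𝔸ˣ) : 𝔸) - 1‖ ≤ a * ((s : ℝ) ^ 2 * ((d : ℝ) * ((d : ℝ) - 1) / 2)) := by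
    refine (norm_hol_sub_one_le_walkSum hV₀m _ _).trans ?_
    rw [T4Continuum.stairWord]
    refine (walkSum_stairRuns_le V hV hP ha q hq.1 hq.2 n _ hndσ q hq.1 hq.2 fun j _ => ⟨hqn.1 j, hqn.2 j⟩).trans ?_
    refine (stairSum_le q ha n hns (fun _ => (0 : ℝ)) _ q 0 fun μ _ => by simp [l1]).trans (le_of_eq ?_)
    rw [hsumσ, hlenσ]; simp
  have hB : ‖((hol V₀ (q + n) (List.replicate L (κ, true)) : 𝔸ˣ) : 𝔸) - 1‖ ≤
      (L : ℝ) * (((s : ℝ) * ∑ j : Fin d, (if j < κ then (1 : ℝ) else 0)) * a) := by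
    refine (norm_hol_sub_one_le_walkSum hV₀m _ _).trans ?_
    have hv : (L : ℤ) • Letter.vec ((κ, true) : Letter d) = (L : ℤ) • e κ := by simp
    refine (walkSum_run_le V hV hP ha q hq.1 hq.2 κ true L (q + n) hqn.1 hqn.2 (by rw [hv]; exact hqnL.1)
      (by rw [hv]; exact hqnL.2)).trans ?_
    rw [add_sub_cancel_left]
    exact mul_le_mul_of_nonneg_left (mul_le_mul_of_nonneg_right (l1_lowPart_le_mul hns κ) ha) (Nat.cast_nonneg _)
  have hC : ‖((hol V₀ (q + (L : ℤ) • e κ) (stairWord σ' n) : 𝔸ˣ) : 𝔸) - 1‖ ≤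
      a * ((s : ℝ) * ((L : ℝ) * ∑ μ : Fin d, (if κ < μ then (1 : ℝ) else 0)) +
        (s : ℝ) ^ 2 * ((d : ℝ) * ((d : ℝ) - 1) / 2)) := by
    refine (norm_hol_sub_one_le_walkSum hV₀m _ _).trans ?_
    rw [T4Continuum.stairWord]
    refine (walkSum_stairRuns_le V hV hP ha q hq.1 hq.2 n _ hndσ' (q + (L : ℤ) • e κ) hqL.1 hqL.2
      fun j _ => ⟨hqLn.1 j, hqLn.2 j⟩).trans ?_
    refine (stairSum_le q ha n hns (fun μ => (L : ℝ) * (if κ < μ then (1 : ℝ) else 0)) _ (q + (L : ℤ) • e κ) 0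
      fun μ _ => by rw [add_sub_cancel_left, l1_lowPart_smul_e, add_zero]).trans (le_of_eq ?_)
    rw [hsumσ', hlenσ', ← Finset.mul_sum]; simp
  have hD : hol V₀ (q + (L : ℤ) • e κ) (List.replicate L (κ, false)) = 1 := by
    rw [← seg_neg_natCast, ← revWord_seg, hol_revWord' V₀ (x := q) _ _ (by rw [disp_seg]), hV₀, hol_axial_seg_base,
      inv_one]
  -- assemble the loop
  have hsplit : hol V₀ q (loopWord L κ n σ σ') =
      hol V₀ q (stairWord σ n) * (hol V₀ (q + n) (List.replicate L (κ, true)) *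
        (hol V₀ (q + n + (L : ℤ) • e κ) (wordRev (stairWord σ' n)) * hol V₀ (q + (L : ℤ) • e κ) (List.replicate L (κ, false)))) := by
    rw [T4Continuum.loopWord, hol_append, disp_stairWord, hol_append, disp_replicate, Letter.vec_true, hol_append,
      wordRev_eq_revWord, disp_revWord, disp_stairWord]
    congr 2
    rw [show q + n + (L : ℤ) • e κ + -n = q + (L : ℤ) • e κ by abel]
  have hCrev : hol V₀ (q + n + (L : ℤ) • e κ) (wordRev (stairWord σ' n)) = (hol V₀ (q + (L : ℤ) • e κ) (stairWord σ' n))⁻¹ := by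
    rw [wordRev_eq_revWord]
    exact hol_revWord' V₀ _ _ (by rw [disp_stairWord]; abel)
  rw [h0, WZ_def, show offZ L (r, σ, σ').1 = n from rfl]
  change ‖((hol V₀ q (loopWord L κ n σ σ') : 𝔸ˣ) : 𝔸) - 1‖ ≤ _
  rw [hsplit, hCrev, hD, mul_one]
  have m1 := hol_mem hV₀m q (stairWord σ n)
  have m2 := hol_mem hV₀m (q + n) (List.replicate L (κ, true))
  have m3 := (U1 𝔸).inv_mem (hol_mem hV₀m (q + (L : ℤ) • e κ) (stairWord σ' n))
  have hsL : ((L : ℝ) - 1) / 2 = s := by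
    have : (L : ℝ) = 2 * s + 1 := by exact_mod_cast hL
    linarith
  calc _ ≤ ‖((hol V₀ q (stairWord σ n) : 𝔸ˣ) : 𝔸) - 1‖ +
        (‖((hol V₀ (q + n) (List.replicate L (κ, true)) : 𝔸ˣ) : 𝔸) - 1‖ +
          ‖(((hol V₀ (q + (L : ℤ) • e κ) (stairWord σ' n))⁻¹ : 𝔸ˣ) : 𝔸) - 1‖) :=
        (norm_units_mul_sub_one_le m1).trans (add_le_add le_rfl (norm_units_mul_sub_one_le m2))
    _ ≤ a * ((s : ℝ) ^ 2 * ((d : ℝ) * ((d : ℝ) - 1) / 2)) +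
        ((L : ℝ) * (((s : ℝ) * ∑ j : Fin d, (if j < κ then (1 : ℝ) else 0)) * a) +
          a * ((s : ℝ) * ((L : ℝ) * ∑ μ : Fin d, (if κ < μ then (1 : ℝ) else 0)) +
            (s : ℝ) ^ 2 * ((d : ℝ) * ((d : ℝ) - 1) / 2))) :=
        add_le_add hA (add_le_add hB ((norm_inv_sub_one_le (hol_mem hV₀m _ _)).trans hC))
    _ = omegaC d L a := by
        have hcnt := sum_lt_add_sum_gt κ (d := d)
        unfold omegaC
        rw [hsL]
        linear_combination (a * (s : ℝ) * (L : ℝ)) * hcnt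

end Loops


/-! ## §6 The exponent and the average (0.4): `|X_c| ≤ 2ω`, `‖Ū_c⁻¹‖ ≤ e^{|X_c|}`, the two straight transporters compared -/

section Average

variable {𝔸 : Type*} [NormedRing 𝔸] [NormOneClass 𝔸] [NormedAlgebra ℂ 𝔸] [CompleteSpace 𝔸]

omit [NormOneClass 𝔸] [CompleteSpace 𝔸] in
/-- A uniform mean of vectors of norm `≤ K` has norm `≤ K`. [cite: Balaban1987RG1, (0.4) p.253 (bookkeeping)] -/
theorem norm_mean_le {ι : Type*} [Fintype ι] [Nonempty ι] (f : ι → 𝔸) {K : ℝ} (hf : ∀ i, ‖f i‖ ≤ K) :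
    ‖∑ i, ((Fintype.card ι : ℝ))⁻¹ • f i‖ ≤ K := by
  have hc : (0 : ℝ) < Fintype.card ι := by exact_mod_cast Fintype.card_pos
  calc ‖∑ i, ((Fintype.card ι : ℝ))⁻¹ • f i‖ ≤ ∑ i, ‖((Fintype.card ι : ℝ))⁻¹ • f i‖ := norm_sum_le _ _
    _ ≤ ∑ _i : ι, ((Fintype.card ι : ℝ))⁻¹ * K := Finset.sum_le_sum fun i _ => by
        rw [norm_smul, Real.norm_eq_abs, abs_of_pos (inv_pos.mpr hc)]
        exact mul_le_mul_of_nonneg_left (hf i) (inv_pos.mpr hc).le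
    _ = K := by rw [Finset.sum_const, Finset.card_univ, nsmul_eq_mul]; field_simp

/-- **The exponent of (0.4)**: `|X_c| ≤ 2ω` once `ω ≤ ½` (every loop variable inside the domain of `log`, `|log W| ≤ 2|W − 1|`).
[cite: Balaban1987RG1, (0.4) p.253; Balaban1985Averaging, (26) p.22] -/
theorem norm_XZ_le {L s : ℕ} (hL : L = 2 * s + 1) (V : Site d → Fin d → 𝔸ˣ) (hV : ∀ x κ, V x κ ∈ U1 𝔸)
    {lo hi : Site d} {a : ℝ} (hP : B8Lemma1NonAbelian.PlaqSmall V lo hi a) (ha : 0 ≤ a) (q : Site d) (κ : Fin d)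
    (hlo : lo ≤ pairLo L q) (hhi : pairHi L q κ ≤ hi) (hω : omegaC d L a ≤ 1 / 2) :
    ‖XZ L V q κ‖ ≤ 2 * omegaC d L a := by
  have : Nonempty (IdxZ d L) := ⟨(fun _ => ⟨0, by omega⟩, 1, 1)⟩
  unfold XZ
  refine norm_mean_le _ fun i => ?_
  have hW := norm_WZ_sub_one_le hL V hV hP ha q κ hlo hhi i
  exact (norm_mlog_le_two_mul (hW.trans hω)).trans (by linarith)

/-- `‖Ū_c⁻¹‖ ≤ e^{‖X_c‖}`: `Ū_c⁻¹ = U(c)⁻¹ exp(−X_c)`. [cite: Balaban1987RG1, (0.4) p.253] -/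
theorem norm_bavgZ_inv_le (L : ℕ) (V : Site d → Fin d → 𝔸ˣ) (hV : ∀ x κ, V x κ ∈ U1 𝔸) (q : Site d)
    (κ : Fin d) {s : ℝ} (hs : ‖XZ L V q κ‖ ≤ s) : ‖(((bavgZ L V q κ)⁻¹ : 𝔸ˣ) : 𝔸)‖ ≤ Real.exp s := by
  rw [bavgZ_apply, mul_inv_rev, Units.val_mul, val_inv_expUnit, val_expUnit]
  calc _ ≤ ‖(((hol V q (seg κ L))⁻¹ : 𝔸ˣ) : 𝔸)‖ * ‖exp (-XZ L V q κ)‖ := norm_mul_le _ _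
    _ ≤ 1 * Real.exp s :=
      mul_le_mul (mem_U1.mp (hol_mem hV _ _)).2 (norm_exp_le_of_norm_le _ (by rwa [norm_neg])) (norm_nonneg _)
        zero_le_one
    _ = Real.exp s := one_mul _

/-- **The two straight transporters compared through the averages (0.4)**: `h := U(c) V₀(c)⁻¹ = exp(−X_c[U]) · Ū_c V̄₀,c⁻¹ · exp(X_c[V₀])`,
hence `|h − 1| ≤ α₁e^{3s} + e^{2s} − 1` if `|X_c[·]| ≤ s` and `|Ū_c − V̄₀,c| ≤ α₁` — the engine's `norm_segRatio_sub_one_le` with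
`bavg ↦ bavgZ`. [cite: Balaban1985RegularSpaces, (1.24) p.79; Balaban1987RG1, (0.4) p.253] -/
theorem norm_segRatio_sub_one_le (L : ℕ) (U V₀ : Site d → Fin d → 𝔸ˣ) (hV₀ : ∀ x κ, V₀ x κ ∈ U1 𝔸)
    (q : Site d) (κ : Fin d) {s α₁ : ℝ} (hs0 : 0 ≤ s) (hsU : ‖XZ L U q κ‖ ≤ s) (hs₀ : ‖XZ L V₀ q κ‖ ≤ s)
    (hα₁ : 0 ≤ α₁) (havg : ‖(bavgZ L U q κ : 𝔸) - bavgZ L V₀ q κ‖ ≤ α₁) :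
    ‖((hol U q (seg κ L) * (hol V₀ q (seg κ L))⁻¹ : 𝔸ˣ) : 𝔸) - 1‖
      ≤ α₁ * Real.exp s ^ 3 + (Real.exp s ^ 2 - 1) := by
  have hid : hol U q (seg κ L) * (hol V₀ q (seg κ L))⁻¹ =
      (expUnit (XZ L U q κ))⁻¹ * (bavgZ L U q κ * (bavgZ L V₀ q κ)⁻¹) * expUnit (XZ L V₀ q κ) := by
    simp only [bavgZ_apply, mul_inv_rev]; group
  rw [hid, Units.val_mul, Units.val_mul, val_inv_expUnit, val_expUnit, val_expUnit]
  have hZ : ‖((bavgZ L U q κ * (bavgZ L V₀ q κ)⁻¹ : 𝔸ˣ) : 𝔸) - 1‖ ≤ α₁ * Real.exp s := by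
    have : ((bavgZ L U q κ * (bavgZ L V₀ q κ)⁻¹ : 𝔸ˣ) : 𝔸) - 1
        = ((bavgZ L U q κ : 𝔸) - bavgZ L V₀ q κ) * (((bavgZ L V₀ q κ)⁻¹ : 𝔸ˣ) : 𝔸) := by
      rw [sub_mul, Units.mul_inv, Units.val_mul]
    rw [this]
    exact (norm_mul_le _ _).trans (mul_le_mul havg (norm_bavgZ_inv_le L V₀ hV₀ q κ hs₀) (norm_nonneg _) hα₁)
  set P : 𝔸 := exp (-XZ L U q κ)
  set Q : 𝔸 := exp (XZ L V₀ q κ)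
  set Z : 𝔸 := ((bavgZ L U q κ * (bavgZ L V₀ q κ)⁻¹ : 𝔸ˣ) : 𝔸)
  have hP : ‖P‖ ≤ Real.exp s := norm_exp_le_of_norm_le _ (by rwa [norm_neg])
  have hQ : ‖Q‖ ≤ Real.exp s := norm_exp_le_of_norm_le _ hs₀
  have hP1 : ‖P - 1‖ ≤ Real.exp s - 1 := B7Transfer.norm_exp_sub_one_le_of_le _ (by rwa [norm_neg])
  have hQ1 : ‖Q - 1‖ ≤ Real.exp s - 1 := B7Transfer.norm_exp_sub_one_le_of_le _ hs₀
  have hE : 1 ≤ Real.exp s := Real.one_le_exp hs0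
  calc _ ≤ ‖P‖ * ‖Z - 1‖ * ‖Q‖ + ‖P - 1‖ * ‖Q‖ + ‖Q - 1‖ := norm_triple_sub_one_le P Z Q
    _ ≤ Real.exp s * (α₁ * Real.exp s) * Real.exp s + (Real.exp s - 1) * Real.exp s + (Real.exp s - 1) := by
      have h1 : ‖P‖ * ‖Z - 1‖ * ‖Q‖ ≤ Real.exp s * (α₁ * Real.exp s) * Real.exp s :=
        mul_le_mul (mul_le_mul hP hZ (norm_nonneg _) (by positivity)) hQ (norm_nonneg _) (by positivity)
      have h2 : ‖P - 1‖ * ‖Q‖ ≤ (Real.exp s - 1) * Real.exp s :=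
        mul_le_mul hP1 hQ (norm_nonneg _) (by linarith)
      linarith
    _ = α₁ * Real.exp s ^ 3 + (Real.exp s ^ 2 - 1) := by ring

end Average

end Literature.MathematicalPhysics.QuantumFieldTheory.Balaban1983to89.B8Lemma1NonAbelianRecLoops

/-! ## Axiom audit (gate whitelist: `propext`, `Classical.choice`, `Quot.sound`) -/
#print axioms Literature.MathematicalPhysics.QuantumFieldTheory.Balaban1983to89.B8Lemma1NonAbelianRecLoops.norm_WZ_sub_one_le
#print axioms Literature.MathematicalPhysics.QuantumFieldTheory.Balaban1983to89.B8Lemma1NonAbelianRecLoops.norm_XZ_le
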